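import Literature.NumberTheory.Automorphic.Liu2021.AppendixC.HeckeTranslates
import Literature.AlgebraicGeometry.Motives.SepQuotientEquivariantIso
import HarnessLib

/-!
# A Hecke translate `T_{γ⁻¹} : X_{N″} → X_N` from a NORMAL sub-level is a finite-group quotient (it is an isomorphism of levels
# followed by a level projection; Milne 2005 §5 / §13, Mumford §7)

Topic `NumberTheory/Automorphic/Liu2021/AppendixC`; namespace `Literature.NumberTheory.Automorphic.Liu2021.AppendixC`.
PROOF FILE (theorems only; no definition, no named fact, no instance, no `sorry`).  Generic over a §4.2 datum `C : Sec42Data` with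
Hecke translates `T : C.HeckeTranslates` ([Milne2005ShimuraVarieties] §13 p. 118: `T(g) : X_K → X_{K′}` for `g⁻¹Kg ⊆ K′`; laws
`T_1 = u`, `T_g ≫ T_{g′} = T_{gg′}`, `T_k = 𝟙` on `X_K` for `k ∈ K`) and the tree's quotient predicate `Motives.IsSepQuotient`.

THE SITUATION (the `T_γ`-letters of a Hecke operator, cell `hodgecm-mathlib` d6 line, `stub_RosH` glue, (L3) «entry recipe» of record,
A-plan2 (g12) 2026-08-30T05:05Z): levels `N″ ≤ K`, `N ≤ K` with `N″` NORMAL in `K`, and `γ` with `γ⁻¹Nγ ⊆ K` (`HeckeLE γ N K`) and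
`γN″γ⁻¹ ⊆ N` (`HeckeLE γ⁻¹ N″ N`).  The translate `T_γ : X_N → X_K` is NOT a Galois quotient in general (`N` would have to be normal in
`γKγ⁻¹` as well), but it is DOMINATED by the Galois level `N″` through the translate

  `q′ := T_{γ⁻¹} : X_{N″} → X_N`,   with   `q′ ≫ T_γ = T_1 = u : X_{N″} → X_K`   (`tr_inv_comp_tr_eq_map`),

and `q′` IS a quotient by a finite group: it factors as the ISOMORPHISM of levels `T_{γ⁻¹} : X_{N″} ⥲ X_{γN″γ⁻¹}` (inverse `T_γ`;
`tr_inv_comp_tr_eq_id`, `tr_comp_tr_inv_eq_id`) followed by the level projection `X_{γN″γ⁻¹} → X_N`, which is a quotient whenever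
`γN″γ⁻¹ ⊴ N` — automatic: `N″ ⊴ K ⊇ γ⁻¹Nγ` (`conj_mem_heckeLevel_of_normal`).  The conjugate level is the tree's `C5.heckeLevel γ N″`
(`= γN″γ⁻¹ ∩ K₀ = γN″γ⁻¹` here).  Hence:

* `exists_isSepQuotient_tr` — if the projection `X_{heckeLevel γ N″} → X_N` is a quotient by `act₃ : Δ →* Aut` for separated test objects
  (the shape ★ `RecordSystemGS.IsLevelQuotient` / (O7) deliver), then `T_{γ⁻¹} : X_{N″} → X_N` is a quotient by the CONJUGATED action
  `Δ →* Aut X_{N″}` (`Iso.conjAut` along the level isomorphism; ★ `IsSepQuotient.precomp_iso`) — same group `Δ`, so finiteness is kept.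

With ★ `exists_subgroup_isSepQuotient_pieceMap'` (pieces) and ★ `AppendixC.Jacobian.exists_galoisCover_letters` (the (F-P2) package) this
gives the Galois letters of `q′` piece by piece, and ★ `levelAdjoint_pushforward_of_dominated'` the adjoint of `Nm(T_γ-piece)`.
COUNT-NEUTRAL capital: HC_CM is proved only modulo the 7 printed citations until rung 0 closes.

## References
* [Milne2005ShimuraVarieties] J. S. Milne, *Introduction to Shimura varieties* (2005), §5 p. 57 L7–12, p. 58 L3–11 (the right action,
  `T(g)`, quotients `Sh_K = Sh_{K′}/(K/K′)` for `K′ ⊴ K`), §13 p. 118 L21–26, Rem. 5.29 (c) p. 65.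
* [MumfordAV1970] D. Mumford, *Abelian Varieties* (1970), §7 Thm. p. 66 and Remark (categorical quotients by finite groups).
* [Deligne1979ShimuraVarieties] P. Deligne, *Variétés de Shimura*, Proc. Symp. Pure Math. 33 (1979), 2.7.1 (b)–(c) / 2.1.2.
-/

set_option autoImplicit false

noncomputable section

open CategoryTheory AlgebraicGeometry NumberField
open Literature.AlgebraicGeometry.Motives

namespace Literature.NumberTheory.Automorphic.Liu2021.AppendixC

universe u v

/-! ## §0 An isomorphism followed by a quotient is a quotient for the conjugated action -/

/-- **`e ≫ p` is a quotient for the conjugated action**: if `p : Y′ ⟶ Z` is a quotient of `Y′` by `act′ : Δ →* Aut Y′` for separated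
test objects and `e : Y ≅ Y′`, then `e.hom ≫ p` is a quotient of `Y` by `δ ↦ e ≪≫ act′ δ ≪≫ e⁻¹` (`Iso.conjAut e.symm ∘ act′`, a group
homomorphism on the SAME group) — ★ `IsSepQuotient.precomp_iso` with the tautological equivariance. [cite: MumfordAV1970, §7 Thm. p. 66 (Remark)] -/
theorem isSepQuotient_iso_hom_comp {k : Type u} [Field k] {Δ : Type v} [Group Δ] {Y Y' Z : SchemeOver k} (e : Y ≅ Y')
    (act' : Δ →* Aut Y') {p : Y' ⟶ Z} (h : IsSepQuotient (fun δ => act' δ) p) :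
    IsSepQuotient (fun δ => (e.symm.conjAut.toMonoidHom.comp act') δ) (e.hom ≫ p) := by
  refine IsSepQuotient.precomp_iso e (fun δ => ?_) h
  change e.hom ≫ (act' δ).hom = (e.symm.conjAut (act' δ)).hom ≫ e.hom
  rw [Iso.conjAut_hom, Iso.conj_apply, Iso.symm_inv, Iso.symm_hom, Category.assoc, Category.assoc, Iso.inv_hom_id,
    Category.comp_id]

/-! ## §1 Level bookkeeping: the conjugate level `γN″γ⁻¹` of a normal sub-level -/

namespace C5

variable {H : Type} [Group H] [TopologicalSpace H] [IsTopologicalGroup H] {K₀ : OpenCompactSubgroup H}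

/-- `γN″γ⁻¹ ⊆ N` (i.e. `HeckeLE γ⁻¹ N″ N`) makes `heckeLevel γ N″ = γN″γ⁻¹ ∩ K₀` an admissible target of `T_{γ⁻¹}` from `N″`:
`HeckeLE γ⁻¹ N″ (heckeLevel γ N″)`. [cite: Milne2005ShimuraVarieties, §13 p. 118 L21–26] -/
theorem heckeLE_inv_heckeLevel {γ : H} {N'' N : SmallLevel K₀} (h : HeckeLE γ⁻¹ N'' N) : HeckeLE γ⁻¹ N'' (heckeLevel γ N'') := by
  intro k hk
  rw [heckeLevel_val]
  refine Subgroup.mem_inf.2 ⟨Subgroup.mem_map.2 ⟨k, hk, ?_⟩, (show N.1.1 ≤ K₀.1 from N.2) (h k hk)⟩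
  rw [MulEquiv.coe_toMonoidHom, MulAut.conj_apply, inv_inv]

/-- `γN″γ⁻¹ ∩ K₀ ≤ N` when `γN″γ⁻¹ ⊆ N`. [cite: Milne2005ShimuraVarieties, §13 p. 118 L21–26] -/
theorem heckeLevel_le_of_heckeLE_inv {γ : H} {N'' N : SmallLevel K₀} (h : HeckeLE γ⁻¹ N'' N) : heckeLevel γ N'' ≤ N := by
  show (heckeLevel γ N'').1.1 ≤ N.1.1
  intro x hx
  rw [heckeLevel_val] at hx
  obtain ⟨k, hk, rfl⟩ := Subgroup.mem_map.1 (Subgroup.mem_inf.1 hx).1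
  have e : (MulAut.conj γ).toMonoidHom k = γ⁻¹⁻¹ * k * γ⁻¹ := by
    rw [MulEquiv.coe_toMonoidHom, MulAut.conj_apply, inv_inv]
  rw [e]
  exact h k hk

/-- **The conjugate of a normal sub-level is normal in the intermediate level**: if `N″ ⊴ K` (`k⁻¹N″k ⊆ N″` for `k ∈ K`) and
`γ⁻¹Nγ ⊆ K` (`HeckeLE γ N K`), then `m⁻¹ (γN″γ⁻¹ ∩ K₀) m ⊆ γN″γ⁻¹ ∩ K₀` for every `m ∈ N` — the hypothesis under which the level
projection `X_{γN″γ⁻¹} → X_N` is a Galois quotient ([Milne2005ShimuraVarieties] §5: `Sh_K = Sh_{K′}/(K/K′)` for `K′ ⊴ K`).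
[cite: Milne2005ShimuraVarieties, §5 p. 57 L7–12 and Rem. 5.29 (c) p. 65] -/
theorem conj_mem_heckeLevel_of_normal {γ : H} {N'' N K : SmallLevel K₀}
    (hn'' : ∀ k ∈ K.1.1, ∀ n ∈ N''.1.1, k⁻¹ * n * k ∈ N''.1.1) (hγ : HeckeLE γ N K) (hle : heckeLevel γ N'' ≤ N) :
    ∀ m ∈ N.1.1, ∀ x ∈ (heckeLevel γ N'').1.1, m⁻¹ * x * m ∈ (heckeLevel γ N'').1.1 := by
  intro m hm x hx
  rw [heckeLevel_val] at hx ⊢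
  obtain ⟨n, hn, rfl⟩ := Subgroup.mem_map.1 (Subgroup.mem_inf.1 hx).1
  have hk : γ⁻¹ * m * γ ∈ K.1.1 := hγ m hm
  have hn' : (γ⁻¹ * m * γ)⁻¹ * n * (γ⁻¹ * m * γ) ∈ N''.1.1 := hn'' _ hk n hn
  refine Subgroup.mem_inf.2 ⟨Subgroup.mem_map.2 ⟨_, hn', ?_⟩, ?_⟩
  · simp only [MulEquiv.coe_toMonoidHom, MulAut.conj_apply]
    group
  · exact N.1.1.mul_mem (N.1.1.mul_mem (N.1.1.inv_mem hm) ((show (heckeLevel γ N'').1.1 ≤ N.1.1 from hle) hx)) hm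
      |> fun h => (show N.1.1 ≤ K₀.1 from N.2) h

end C5

/-! ## §2 The translate `T_{γ⁻¹} : X_{N″} → X_N` through the conjugate level -/

section Sec42

variable {F E : Type} [Field F] [NumberField F] [IsTotallyReal F] [Field E] [NumberField E] [Algebra F E]
  [IsTotallyComplex E] [Algebra.IsQuadraticExtension F E]
variable {P5 : PropC5Data F E} {isotropicAt : ℕ → Prop}

namespace Sec42Data.HeckeTranslates

variable {C : Sec42Data P5 isotropicAt} (T : C.HeckeTranslates)

/-- **`T_{γ⁻¹} ≫ T_γ = u`**: the translate `X_{N″} → X_N` by `γ⁻¹` followed by the translate `X_N → X_K` by `γ` is the level projection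
`X_{N″} → X_K` (`T_{γ⁻¹γ} = T_1 = u`) — the domination `q′ ≫ T_γ = u″` of the (L3) recipe.
[cite: Milne2005ShimuraVarieties, §5 p. 58 L3–11 and §13 p. 118 L21–26] -/
theorem tr_inv_comp_tr_eq_map (γ : C.G) {N'' N K : C5.SmallLevel C.S.K₀} (h₁ : C5.HeckeLE γ⁻¹ N'' N)
    (h₂ : C5.HeckeLE γ N K) (hle : N'' ≤ K) :
    T.tr γ⁻¹ N'' N h₁ ≫ T.tr γ N K h₂ = C.cpt.X.map (homOfLE hle) := by
  rw [T.tr_mul, ← T.tr_one (homOfLE hle)]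
  exact T.tr_congr (inv_mul_cancel γ) _ _

/-- `T_{γ⁻¹} : X_{N″} → X_{γN″γ⁻¹}` followed by `T_γ` back is the identity (`T_{γ⁻¹γ} = T_1 = 𝟙` on `X_{N″}`).
[cite: Milne2005ShimuraVarieties, §5 p. 57 L7–12 and p. 58 L6–11] -/
theorem tr_inv_comp_tr_eq_id (γ : C.G) {N'' N₃ : C5.SmallLevel C.S.K₀} (h₁ : C5.HeckeLE γ⁻¹ N'' N₃) (h₂ : C5.HeckeLE γ N₃ N'') :
    T.tr γ⁻¹ N'' N₃ h₁ ≫ T.tr γ N₃ N'' h₂ = 𝟙 (C.X N'') := by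
  rw [T.tr_mul, ← T.tr_self (K := N'') (one_mem N''.1.1)]
  exact T.tr_congr (inv_mul_cancel γ) _ _

/-- `T_γ : X_{γN″γ⁻¹} → X_{N″}` followed by `T_{γ⁻¹}` back is the identity. [cite: Milne2005ShimuraVarieties, §5 p. 57 L7–12 and p. 58 L6–11] -/
theorem tr_comp_tr_inv_eq_id (γ : C.G) {N'' N₃ : C5.SmallLevel C.S.K₀} (h₁ : C5.HeckeLE γ⁻¹ N'' N₃) (h₂ : C5.HeckeLE γ N₃ N'') :
    T.tr γ N₃ N'' h₂ ≫ T.tr γ⁻¹ N'' N₃ h₁ = 𝟙 (C.X N₃) := by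
  rw [T.tr_mul, ← T.tr_self (K := N₃) (one_mem N₃.1.1)]
  exact T.tr_congr (mul_inv_cancel γ) _ _

/-- **THE TRANSLATE `T_{γ⁻¹} : X_{N″} → X_N` IS A QUOTIENT BY A FINITE GROUP whenever the level projection from the conjugate level
`γN″γ⁻¹` is.**  If `X_{heckeLevel γ N″} → X_N` is a quotient of `X_{heckeLevel γ N″}` by `act₃ : Δ →* Aut` for separated test objects (the
output shape of ★ `RecordSystemGS.IsLevelQuotient` at `γN″γ⁻¹ ≤ N`, normality by `conj_mem_heckeLevel_of_normal`), then
`T_{γ⁻¹} : X_{N″} → X_N` (`HeckeLE γ⁻¹ N″ N`) is a quotient of `X_{N″}` by the conjugate action of the SAME group `Δ` along the level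
isomorphism `T_{γ⁻¹} : X_{N″} ⥲ X_{γN″γ⁻¹}` — `T(g)` induces `Sh_K ≅ Sh_{g⁻¹Kg}` and the projections are quotients `Sh_{K′}/(K/K′)`
([Milne2005ShimuraVarieties] §5, §13). [cite: Milne2005ShimuraVarieties, §5 p. 57 L7–12, p. 58 L3–11 and Rem. 5.29 (c) p. 65; §13 p. 118 L21–26]
[cite: MumfordAV1970, §7 Thm. p. 66 (Remark)] -/
theorem exists_isSepQuotient_tr (γ : C.G) {N'' N : C5.SmallLevel C.S.K₀} (h : C5.HeckeLE γ⁻¹ N'' N)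
    {Δ : Type v} [Group Δ] (act₃ : Δ →* Aut (C.X (C5.heckeLevel γ N'')))
    (hq : IsSepQuotient (fun δ => act₃ δ) (C.cpt.X.map (homOfLE (C5.heckeLevel_le_of_heckeLE_inv h)))) :
    ∃ act : Δ →* Aut (C.X N''), IsSepQuotient (fun δ => act δ) (T.tr γ⁻¹ N'' N h) := by
  have h₁ : C5.HeckeLE γ⁻¹ N'' (C5.heckeLevel γ N'') := C5.heckeLE_inv_heckeLevel h
  have h₂ : C5.HeckeLE γ (C5.heckeLevel γ N'') N'' := C5.heckeLE_heckeLevel γ N''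
  let e : C.X N'' ≅ C.X (C5.heckeLevel γ N'') :=
    ⟨T.tr γ⁻¹ N'' _ h₁, T.tr γ _ N'' h₂, T.tr_inv_comp_tr_eq_id γ h₁ h₂, T.tr_comp_tr_inv_eq_id γ h₁ h₂⟩
  refine ⟨e.symm.conjAut.toMonoidHom.comp act₃, ?_⟩
  have htr : T.tr γ⁻¹ N'' N h = e.hom ≫ C.cpt.X.map (homOfLE (C5.heckeLevel_le_of_heckeLE_inv h)) := by
    change _ = T.tr γ⁻¹ N'' _ h₁ ≫ _
    rw [T.tr_comp_map]
  rw [htr]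
  exact isSepQuotient_iso_hom_comp e act₃ hq

/-- The same with the domination packaged: `T_{γ⁻¹} : X_{N″} → X_N` is a quotient by the conjugate action AND composes with `T_γ` to the
level projection `X_{N″} → X_K` — the two facts the (L3) recipe consumes for the letter `Nm(T_γ)`.
[cite: Milne2005ShimuraVarieties, §5 p. 58 L3–11 and §13 p. 118 L21–26] [cite: MumfordAV1970, §7 Thm. p. 66 (Remark)] -/
theorem exists_isSepQuotient_tr_comp (γ : C.G) {N'' N K : C5.SmallLevel C.S.K₀} (h : C5.HeckeLE γ⁻¹ N'' N)
    (hγ : C5.HeckeLE γ N K) (hle : N'' ≤ K)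
    {Δ : Type v} [Group Δ] (act₃ : Δ →* Aut (C.X (C5.heckeLevel γ N'')))
    (hq : IsSepQuotient (fun δ => act₃ δ) (C.cpt.X.map (homOfLE (C5.heckeLevel_le_of_heckeLE_inv h)))) :
    ∃ act : Δ →* Aut (C.X N''), IsSepQuotient (fun δ => act δ) (T.tr γ⁻¹ N'' N h) ∧
      T.tr γ⁻¹ N'' N h ≫ T.tr γ N K hγ = C.cpt.X.map (homOfLE hle) := by
  obtain ⟨act, hact⟩ := T.exists_isSepQuotient_tr γ h act₃ hq
  exact ⟨act, hact, T.tr_inv_comp_tr_eq_map γ h hγ hle⟩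

end Sec42Data.HeckeTranslates

end Sec42

end Literature.NumberTheory.Automorphic.Liu2021.AppendixC

end
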